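import Literature.MathematicalPhysics.QuantumFieldTheory.Balaban1983to89.B1Sect3Statements

/-!
# `Balaban1983to89.B1Ineq353Proof` — T. Bałaban, *(Higgs)₂,₃ quantum fields in a finite volume. I. A lower bound*,
Commun. Math. Phys. **85** (1982) 603–626 [Balaban1982Higgs1]: the in-proof restriction analysis **(3.53)** p. 621 and
its conclusion p. 622 (the characteristic function `χ_k(φ′ + aL⁻²C^{(k)}(B^{(k+1)})Q*(B^{(k+1)})ψ)` is REDUNDANT on the
support of `χ_{k+1}(ψ)χ(φ′)` once `c₁p₁(L^kε) + p(L^{k+1}ε) + c₂(L^kε)^α ≤ p(L^kε)`), and the step **(3.51) ⇒ (3.55)**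
p. 622 (dropping the redundant `χ_k`'s and factoring the Gaussian normalisations `∫dA′e^{−½⟨A′,(C^{(k)})⁻¹A′⟩}`,
`∫dφ′e^{−½⟨φ′,(C^{(k)}(B^{(k+1)}))⁻¹φ′⟩}` out of the fluctuation integral, which becomes the `dμ_{C^{(k)}}`-integral (3.56)),
PROVED over the tree's schematic B1 §3 vocabulary (`B1LowerBound.bgField` (3.29), `B1LowerBound.SmallFieldAt` (3.27)–(3.28),
`B1Sect3Statements.transl310` (3.48), `SmallFluct` (3.50), `SmallFieldUnit` (3.9), `Ineq354` (3.54), `integral356` (3.56),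
`B2.pFn` = p(·)); theorems only

statement-level skeleton of published theorems with citation tags; proofs where landed; nothing here is a claim about the Yang–Mills mass gap

PDF held: `paper:balaban1982-cmp85-higgs23-i` (journal page = PDF page + 602); the displays (3.48)–(3.56) and the sentences
between them were READ AS IMAGES on the x2 renders
`run/shared/lean/pub/pub-balaban/b2b-balaban-ref1/pages/1982-cmp85-higgs23-I/1982-cmp85-higgs23-I-p019-x2.png` (p. 621) and
`…-p020-x2.png` (p. 622).

CITATION HEADER (lean-in-tree rule).  WHAT IS REPRODUCED — SKELETON rows **B1.Eq3.53** (reader r12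
`lit-balaban-r12/ROWS-B1-part2.md`: «the restricted field … ≤ c₁p₁(L^kε) + L^{−(d−2)/2}p(L^{k+1}ε) + c₂(L^kε)^α (p.622);
absent · in-proof expression + bound»), the p. 622 sentence filed by r12 under **B1.Eq3.54** («⇒ χ_{k+1}(ψ)χ_k(φ′+…ψ)χ(φ′) =
χ_{k+1}(ψ)χ(φ′)»; the threshold inequality itself is `B1Sect3Statements.Ineq354`, served by `B1Ineq354Proof`), and
**B1.Eq3.55** («RHS(3.51) ≥ const Z_kZ_k(B^{(k+1)})exp(…)(Gaussian normalisations)χ_{k+1}χ_{k+1}∫dμ_{C^{(k)}}(A′)∫dμ(φ′)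
χ(A′)χ(φ′)exp(V^{(k)} − E₀ + O(1)(L^kε)^κ∣T₁^{(k)}∣); absent · integral inequality»).  Verbatim, p. 621 [PDF 19] after (3.52):
*"The function χ_k(φ′ + aL⁻²C^{(k)}(B^{(k+1)})Q*(B^{(k+1)})ψ) gives the restrictions on the field*
`a_kG_k(A′^{(k)} + B^{(k+1)})Q*_k(A′^{(k)} + B^{(k+1)})φ′ + a_kaL⁻²G_k(A′^{(k)} + B^{(k+1)})Q*_k(A′^{(k)} + B^{(k+1)})C^{(k)}(B^{(k+1)})Q*(B^{(k+1)})ψ.` **(3.53)**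
*From (3.50) it follows that the first term above and its covariant Laplacian can be estimated by c₁p₁(L^kε) with c₁
independent of k, ε. Now if we expand the second term in (3.53), and the Laplacian of this term, with respect to the field
A′^{(k)} using (3.15), (3.16), and (3.44), then the first term of this expansion is equal to ψ^{(k+1)} or
Δ^η_{B^{(k+1)}}ψ^{(k+1)} and the sum of the remaining terms can be estimated by c₂(L^kε)^α for"* [p. 622] *"some α > 0 with
a constant c₂ independent of k, ε. Hence the expression (3.53) can be estimated by c₁p₁(L^kε) + L^{−(d−2)/2}p(L^{k+1}ε) +
c₂(L^kε)^α and the Laplacian Δ^η_{A′^{(k)}+B^{(k+1)}} of this expression can be estimated by c₁p₁(L^kε) +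
L^{−(d+2)/2}p(L^{k+1}ε) + c₂(L^kε)^α. Then we have*
`χ_{k+1}(ψ)χ_k(φ′ + aL⁻²C^{(k)}(B^{(k+1)})Q*(B^{(k+1)})ψ)χ_k(φ′) = χ_{k+1}(ψ)χ_k(φ′)`
*if c₁p₁(L^kε) + p(L^{k+1}ε) + c₂(L^kε)^α ≤ p(L^kε), and this inequality is satisfied if e.g. … (3.54) where we have
assumed L^{k+1}ε ≤ 1. … Hence we have (the right side of (3.51)) ≥ const Z_kZ_k(B^{(k+1)})·exp(−½⟨B, Δ^{(k+1),L}B⟩ −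
½⟨ψ, Δ^{(k+1),L}(B^{(k+1)})ψ⟩)·(∫dA′ exp(−½⟨A′, (C^{(k)})⁻¹A′⟩))(∫dφ′ exp(−½⟨φ′, (C^{(k)}(B^{(k+1)}))⁻¹φ′⟩))
·χ_{k+1}(B)χ_{k+1}(ψ)∫dμ_{C^{(k)}}(A′)∫dμ_{C^{(k)}(B^{(k+1)})}(φ′)χ(A′)χ(φ′)·exp(V^{(k)} − E₀ + O(1)(L^kε)^κ|T₁^{(k)}|). (3.55)"*,
where (3.51) p. 621 reads *"(3.38) ≥ const Z_kZ_k(B^{(k+1)})exp(−½⟨B, Δ^{(k+1),L}B⟩ − ½⟨ψ, Δ^{(k+1),L}(B^{(k+1)})ψ⟩)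
·χ_{k+1}(B)χ_{k+1}(ψ)·∫dA′∫dφ′ χ_k(A′ + aL⁻²C^{(k)}Q*B)χ_k(φ′ + aL⁻²C^{(k)}(B^{(k+1)})Q*(B^{(k+1)})ψ)·χ(A′)χ(φ′)
exp[−½⟨A′, (C^{(k)})⁻¹A′⟩ − ½⟨φ′, (C^{(k)}(B^{(k+1)}))⁻¹φ′⟩ + V^{(k)}(B^{(k+1)}, ψ, A′^{(k)}, φ′) − E₀ + O(1)(L^kε)^κ|T₁^{(k)}|]"*.
READING NOTE (recorded in HOME/GAPS.md): in the displayed identity p. 622 the third factor is printed `χ_k(φ′)` on both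
sides; by (3.50)/(3.51)/(3.55) (and the first-step twin (3.21) p. 615, *"χ₁(ψ)χ(φ′)χ₀(φ′ + ψ^{(1)}) = χ₁(ψ)χ(φ′)"*) it is
the fluctuation restriction `χ(φ′)` of (3.50) — a print slip, immaterial; typed here with `χ(φ′)` (`SmallFluct`).

THE MODEL (schematic, exactly as in `…B1LowerBound`/`…B1Sect3Statements`/`…B1Ineq352Proof`, cell DIVERGENCE D-b01.3:
abstract carriers; the operators the paper constructs in Sect. 2 are explicit linear maps and their two printed analytic
properties are explicit hypotheses — displayed, not derived).  All lattices of the (k+1)-st step in the units of p. 619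
(unit lattice `T₁^{(k)}`): `Z` ↤ the η-lattice sites (where the background fields (3.29) live), `X` ↤ `T₁^{(k)}` (the
fluctuation field `φ′`, (3.48)), `Y` ↤ `T_L^{(k+1)}` (the new block field `ψ`); `V` ↤ `ℝ^N` (any real normed space);
`G, Qsk` ↤ `G_k(Ã), Q*_k(Ã)` in the background `Ã = A′^{(k)} + B^{(k+1)}`, so that the level-k background-field map of
(3.49) is `φ ↦ φ^{(k)} = B1LowerBound.bgField a_k 1 G Qsk φ = a_k·G_k(Ã)Q*_k(Ã)φ` ((3.29) rescaled); `C, Qs` ↤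
`C^{(k)}(B^{(k+1)}), Q*(B^{(k+1)})`, so that (3.48) is `φ = B1Sect3Statements.transl310 (aL⁻²) C Qs φ′ ψ`; `ψk1 : Z → V` ↤
`ψ^{(k+1)} = a_{k+1}L⁻²G_{k+1}(B^{(k+1)})Q*_{k+1}(B^{(k+1)})ψ` ((3.29) at level k+1, cf. (3.49) — on the concrete Sect. 2
carrier `B1RG242.StepData` the identity "second term of (3.53) at A′ = 0 = ψ^{(k+1)}" IS `B1Eq333Decomposition.eq342`);
`lapA, lapB` ↤ the covariant Laplacians `Δ^η_{Ã}`, `Δ^η_{B^{(k+1)}}`; thresholds `p1` ↤ `p₁(L^kε)`, `pp` ↤ `p(L^{k+1}ε)`, `pk` ↤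
`p(L^kε)` (`B2.pFn`), `ℓk` ↤ `L^kε`.  The restrictions: `χ(φ′) = 1` ↦ `SmallFluct p1 (‖φ′ ·‖)` ((3.50)); `χ_{k+1}(ψ) = 1` ↦
`∀ z, SmallFieldAt d L pp ‖ψ^{(k+1)} z‖ ‖(Δ_Bψ^{(k+1)}) z‖` ((3.28) at spacing `L^{k+1}ε`, rescaled by `L^kε`, as in
`B1Ineq352Proof`); `χ_k(φ) = 1` ↦ `SmallFieldUnit pk (‖φ^{(k)} ·‖) (‖(Δ_Ãφ^{(k)}) ·‖)` ((3.28) at spacing `L^kε` rescaled =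
(3.9)-shape, `smallFieldUnit_iff`).  The two printed analytic inputs: (H1) *"from (3.50) … the first term and its covariant
Laplacian can be estimated by c₁p₁(L^kε)"* ↦ a sup-norm bound of `φ′ ↦ φ′^{(k)}` and of `Δ_Ã ∘ (φ′ ↦ φ′^{(k)})` with
constant `c₁`; (H2) *"the first term of this expansion is equal to ψ^{(k+1)} or Δ^η_{B^{(k+1)}}ψ^{(k+1)} and the sum of
the remaining terms can be estimated by c₂(L^kε)^α"* ↦ pointwise bounds `‖(2nd term − ψ^{(k+1)})(z)‖ ≤ c₂ℓk^α`,
`‖(Δ_Ã(2nd term) − Δ_Bψ^{(k+1)})(z)‖ ≤ c₂ℓk^α`.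

WHAT THIS FILE PROVES (theorems only — no `def`, no new `Prop` fact; 0 `sorry`; standard axioms):
* `eq353` — (3.53) IS the level-k background field of the translated field (3.48): `φ^{(k)}[φ′ + aL⁻²CQ*ψ] =
  a_kG_kQ*_kφ′ + a_kaL⁻²G_kQ*_kC^{(k)}Q*ψ` (linearity of (3.29)); `secondTerm_eq` — the second term with the printed scalar
  `a_kaL⁻²`.
* `norm_field353_le`, `norm_lap_field353_le`, **`ineq353`** — the two p. 622 bounds: `‖(3.53)(z)‖ ≤ c₁p₁(L^kε) +
  L^{−(d−2)/2}p(L^{k+1}ε) + c₂(L^kε)^α` and `‖Δ_Ã(3.53)(z)‖ ≤ c₁p₁(L^kε) + L^{−(d+2)/2}p(L^{k+1}ε) + c₂(L^kε)^α`, from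
  (H1), (H2), `χ_{k+1}(ψ) = 1`, `χ(φ′) = 1`; `ineq353_vector` — the vector-field case (*"even simpler"*: the second term is
  `B^{(k+1)}` on the nose by (3.42), no `c₂`-term).
* **`chi_k_of_ineq354`** / **`chi_k_of_ineq354_printed`** — THE SENTENCE: under `c₁p₁(L^kε) + p(L^{k+1}ε) + c₂(L^kε)^α ≤
  p(L^kε)` (`B1Sect3Statements.Ineq354`), `L ≥ 1` and **`d ≥ 2`** (this is where `L^{−(d∓2)/2} ≤ 1` is used — the paper has
  `d = 2, 3`), the restriction `χ_k(φ′ + aL⁻²C^{(k)}Q*ψ) = 1` HOLDS; **`chi_product_eq`** — the same AS PRINTED, an identity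
  of products of {0,1}-valued characteristic functions `χ_{k+1}(ψ)·χ_k(φ′ + …ψ)·χ(φ′) = χ_{k+1}(ψ)·χ(φ′)`
  (`indicator_mul_redundant`).
* **`integral_mul_density_eq`**, `density_norm_eq`, `normalized_exists` — the Gaussian-normalisation bookkeeping of (3.55)
  for ONE field, over an arbitrary measure space: if `g ≥ 0` is a density with `g·dν = N·dμ` (`μ` the normalised measure
  `dμ_C`, `N = ∫g dν` when `μ` is a probability measure), then `∫F·g dν = N·∫F dμ`; such a `μ` exists whenever `0 < N < ∞`.
* **`step355`**, **`eq355`**, **`ineq355`** — (3.51) ⇒ (3.55): if the two `χ_k` factors equal `1` wherever `χ(A′)χ(φ′) ≠ 0`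
  (the sentence above, for the scalar and the vector field), then the double fluctuation integral of (3.51) EQUALS
  `(∫dA′e^{−½q_A})(∫dφ′e^{−½q_φ})·e^{−E₀+R}·B1Sect3Statements.integral356 μ_A μ_φ χ(A′) χ(φ′) V^{(k)}` (`R` ↤ the number
  `O(1)(L^kε)^κ|T₁^{(k)}|`), hence the printed `≥` after multiplication by the common non-negative prefactor
  `const Z_kZ_k(B^{(k+1)})exp(…)χ_{k+1}(B)χ_{k+1}(ψ)`.
HONEST SCOPE.  (H1) and (H2) are the paper's two analytic claims at this point (regularity of `G_k`, Props. 2.2–2.3, and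
the expansions (3.15)/(3.16)/(3.44)); they are hypotheses here, with their printed justification quoted, not derived —
exactly as the operator properties in `B1Ineq352Proof`.  What is kernel-checked is the assembly: the split (3.53), the
two triangle inequalities with the printed exponents, the threshold logic of the sentence (incl. the rôle of `d ≥ 2`,
`L ≥ 1`, `L^{k+1}ε ≤ 1`), the characteristic-function identity, and the measure-theoretic identity (3.51) = (3.55).
Unit `lit-balaban-p14` gen 3 (Phase-2 proof seat p14, literature-prover-lit-balaban-p14-g3-0), HOME
`run/shared/lean/pub/lit-balaban/` (seat log `lit-balaban-p14/STATUS.md`).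
-/

namespace Literature.MathematicalPhysics.QuantumFieldTheory.Balaban1983to89.B1Ineq353Proof

open Literature.MathematicalPhysics.QuantumFieldTheory.Balaban1983to89
open B1LowerBound B1Sect3Statements MeasureTheory

/-! ## §1 (3.53): the restricted field is `φ^{(k)}` of the translated field (3.48); its two terms -/

section Model

variable {Z X Y V : Type} [NormedAddCommGroup V] [NormedSpace ℝ V]
variable (G lapA lapB : (Z → V) →ₗ[ℝ] (Z → V)) (Qsk : (X → V) →ₗ[ℝ] (Z → V)) (C : (X → V) →ₗ[ℝ] (X → V))
  (Qs : (Y → V) →ₗ[ℝ] (X → V))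

/-- **(3.53) p. 621** — the field displayed in (3.53) is the level-k background field (3.29)/(3.49)
`φ^{(k)} = a_kG_k(Ã)Q*_k(Ã)φ` of the translated field (3.48) `φ = φ′ + aL⁻²C^{(k)}(B^{(k+1)})Q*(B^{(k+1)})ψ`, and it is the
SUM of the two printed terms `a_kG_kQ*_kφ′ + a_kG_kQ*_k(aL⁻²C^{(k)}Q*ψ)` (linearity of (3.29), `bgField_add`).
[cite: Balaban1982Higgs1, (3.53) p.621] -/
theorem eq353 (ak a L : ℝ) (φ' : X → V) (ψ : Y → V) :
    bgField ak 1 G Qsk (transl310 (a * (L ^ 2)⁻¹) C Qs φ' ψ)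
      = bgField ak 1 G Qsk φ' + bgField ak 1 G Qsk ((a * (L ^ 2)⁻¹) • C (Qs ψ)) := by
  rw [transl310, bgField_add]

/-- The second term of (3.53) with its printed scalar: `a_kG_kQ*_k(aL⁻²C^{(k)}Q*ψ) = a_kaL⁻²·G_kQ*_kC^{(k)}Q*ψ`.
[cite: Balaban1982Higgs1, (3.53) p.621] -/
theorem secondTerm_eq (ak a L : ℝ) (ψ : Y → V) :
    bgField ak 1 G Qsk ((a * (L ^ 2)⁻¹) • C (Qs ψ)) = (ak * (a * (L ^ 2)⁻¹)) • G (Qsk (C (Qs ψ))) := by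
  simp only [bgField, map_smul, smul_smul, one_pow, inv_one, mul_one]

/-! ## §2 The two p. 622 bounds on (3.53) and on its covariant Laplacian -/

/-- p. 622 ll. 1–2, the bound on the field (3.53) from its three displayed constituents: if the first term is bounded by
`c₁p₁` (H1 at `χ(φ′) = 1`), the second term differs from `ψ^{(k+1)}` by at most `c₂ℓk^α` (H2), and `χ_{k+1}(ψ) = 1` gives
`‖ψ^{(k+1)}(z)‖ ≤ L^{−(d−2)/2}p(L^{k+1}ε)`, then `‖(3.53)(z)‖ ≤ c₁p₁(L^kε) + L^{−(d−2)/2}p(L^{k+1}ε) + c₂(L^kε)^α`.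
[cite: Balaban1982Higgs1, (3.53) p.621–622] -/
theorem norm_field353_le {ak a L c₁ c₂ ℓk α p1 pp : ℝ} {d : ℕ} {φ' : X → V} {ψ : Y → V} {ψk1 : Z → V}
    (hfirst : ∀ z, ‖bgField ak 1 G Qsk φ' z‖ ≤ c₁ * p1)
    (hsecond : ∀ z, ‖(bgField ak 1 G Qsk ((a * (L ^ 2)⁻¹) • C (Qs ψ)) - ψk1) z‖ ≤ c₂ * ℓk ^ α)
    (hchi1 : ∀ z, ‖ψk1 z‖ ≤ L ^ (-(((d : ℝ) - 2) / 2)) * pp) (z : Z) :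
    ‖bgField ak 1 G Qsk (transl310 (a * (L ^ 2)⁻¹) C Qs φ' ψ) z‖
      ≤ c₁ * p1 + L ^ (-(((d : ℝ) - 2) / 2)) * pp + c₂ * ℓk ^ α := by
  have hsplit : bgField ak 1 G Qsk (transl310 (a * (L ^ 2)⁻¹) C Qs φ' ψ) z
      = bgField ak 1 G Qsk φ' z + ψk1 z + (bgField ak 1 G Qsk ((a * (L ^ 2)⁻¹) • C (Qs ψ)) - ψk1) z := by
    rw [eq353, Pi.add_apply, Pi.sub_apply]
    abel
  rw [hsplit]
  exact (norm_add₃_le).trans (add_le_add_three (hfirst z) (hchi1 z) (hsecond z))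

/-- p. 622 ll. 2–4, the bound on the covariant Laplacian `Δ^η_{Ã}` of (3.53): with the Laplacian of the first term
bounded by `c₁p₁` (H1), `Δ_Ã(second term) − Δ_Bψ^{(k+1)}` bounded by `c₂ℓk^α` (H2), and `χ_{k+1}(ψ) = 1` giving
`‖(Δ_Bψ^{(k+1)})(z)‖ ≤ L^{−(d+2)/2}p(L^{k+1}ε)`: `‖(Δ_Ã(3.53))(z)‖ ≤ c₁p₁(L^kε) + L^{−(d+2)/2}p(L^{k+1}ε) + c₂(L^kε)^α`.
[cite: Balaban1982Higgs1, (3.53) p.621–622] -/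
theorem norm_lap_field353_le {ak a L c₁ c₂ ℓk α p1 pp : ℝ} {d : ℕ} {φ' : X → V} {ψ : Y → V} {ψk1 : Z → V}
    (hfirst : ∀ z, ‖lapA (bgField ak 1 G Qsk φ') z‖ ≤ c₁ * p1)
    (hsecond : ∀ z, ‖(lapA (bgField ak 1 G Qsk ((a * (L ^ 2)⁻¹) • C (Qs ψ))) - lapB ψk1) z‖ ≤ c₂ * ℓk ^ α)
    (hchi1 : ∀ z, ‖lapB ψk1 z‖ ≤ L ^ (-(((d : ℝ) + 2) / 2)) * pp) (z : Z) :
    ‖lapA (bgField ak 1 G Qsk (transl310 (a * (L ^ 2)⁻¹) C Qs φ' ψ)) z‖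
      ≤ c₁ * p1 + L ^ (-(((d : ℝ) + 2) / 2)) * pp + c₂ * ℓk ^ α := by
  have hsplit : lapA (bgField ak 1 G Qsk (transl310 (a * (L ^ 2)⁻¹) C Qs φ' ψ)) z
      = lapA (bgField ak 1 G Qsk φ') z + lapB ψk1 z
        + (lapA (bgField ak 1 G Qsk ((a * (L ^ 2)⁻¹) • C (Qs ψ))) - lapB ψk1) z := by
    rw [eq353, map_add, Pi.add_apply, Pi.sub_apply]
    abel
  rw [hsplit]
  exact (norm_add₃_le).trans (add_le_add_three (hfirst z) (hchi1 z) (hsecond z))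

/-- **(3.53) and its two p. 622 bounds** from the printed inputs: (H1) the sup-norm bounds with constant `c₁` of
`φ′ ↦ φ′^{(k)} = a_kG_k(Ã)Q*_k(Ã)φ′` and of its covariant Laplacian (*"from (3.50) it follows …"*); (H2) the expansion of
the second term and of its Laplacian around `ψ^{(k+1)}`, `Δ^η_{B^{(k+1)}}ψ^{(k+1)}` with remainder `≤ c₂(L^kε)^α`
(*"using (3.15), (3.16), and (3.44)"*); `χ(φ′) = 1` ((3.50), `SmallFluct p1`, `p1 = p₁(L^kε)`); `χ_{k+1}(ψ) = 1` ((3.28) at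
`L^{k+1}ε` in the units of `L^kε`: `SmallFieldAt d L pp` on `ψ^{(k+1)} = bgField a_{k+1} L G_{k+1} Q*_{k+1} ψ`, `pp = p(L^{k+1}ε)`).
Conclusion: `‖(3.53)(z)‖ ≤ c₁p₁ + L^{−(d−2)/2}pp + c₂ℓk^α` and `‖(Δ_Ã(3.53))(z)‖ ≤ c₁p₁ + L^{−(d+2)/2}pp + c₂ℓk^α` at every
site `z`. [cite: Balaban1982Higgs1, (3.53) p.621–622] -/
theorem ineq353 (G1 : (Z → V) →ₗ[ℝ] (Z → V)) (Qs1 : (Y → V) →ₗ[ℝ] (Z → V))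
    {ak ak1 a L c₁ c₂ ℓk α p1 pp : ℝ} {d : ℕ} {φ' : X → V} {ψ : Y → V}
    (hfirst : ∀ (f : X → V) (M : ℝ), (∀ x, ‖f x‖ ≤ M) →
      ∀ z, ‖bgField ak 1 G Qsk f z‖ ≤ c₁ * M ∧ ‖lapA (bgField ak 1 G Qsk f) z‖ ≤ c₁ * M)
    (hsecond : ∀ z, ‖(bgField ak 1 G Qsk ((a * (L ^ 2)⁻¹) • C (Qs ψ)) - bgField ak1 L G1 Qs1 ψ) z‖ ≤ c₂ * ℓk ^ α
      ∧ ‖(lapA (bgField ak 1 G Qsk ((a * (L ^ 2)⁻¹) • C (Qs ψ))) - lapB (bgField ak1 L G1 Qs1 ψ)) z‖ ≤ c₂ * ℓk ^ α)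
    (hchi : SmallFluct p1 (fun x => ‖φ' x‖))
    (hchi1 : ∀ z, SmallFieldAt d L pp ‖bgField ak1 L G1 Qs1 ψ z‖ ‖lapB (bgField ak1 L G1 Qs1 ψ) z‖) (z : Z) :
    ‖bgField ak 1 G Qsk (transl310 (a * (L ^ 2)⁻¹) C Qs φ' ψ) z‖
        ≤ c₁ * p1 + L ^ (-(((d : ℝ) - 2) / 2)) * pp + c₂ * ℓk ^ α
      ∧ ‖lapA (bgField ak 1 G Qsk (transl310 (a * (L ^ 2)⁻¹) C Qs φ' ψ)) z‖
        ≤ c₁ * p1 + L ^ (-(((d : ℝ) + 2) / 2)) * pp + c₂ * ℓk ^ α :=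
  ⟨norm_field353_le G Qsk C Qs (fun z => (hfirst φ' p1 hchi z).1) (fun z => (hsecond z).1) (fun z => (hchi1 z).1) z,
    norm_lap_field353_le G lapA lapB Qsk C Qs (fun z => (hfirst φ' p1 hchi z).2) (fun z => (hsecond z).2)
      (fun z => (hchi1 z).2) z⟩

/-- **The vector-field case** (*"the considerations for vector fields are even simpler"*, p. 621): for the vector fields
the second term of the analogue of (3.53) IS `B^{(k+1)}` — (3.42) p. 619, `A^{(k)}[A′ + aL⁻²C^{(k)}Q*B] = A′^{(k)} + B^{(k+1)}`,
no expansion, no `c₂`-term (`B1Eq333Decomposition.eq342` on the concrete carrier) — and the Laplacian is the plain `Δ^η`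
for both: `‖A^{(k)}(z)‖ ≤ c₁p₁ + L^{−(d−2)/2}pp`, `‖(ΔA^{(k)})(z)‖ ≤ c₁p₁ + L^{−(d+2)/2}pp`.
[cite: Balaban1982Higgs1, (3.53) p.621–622] -/
theorem ineq353_vector (G1 : (Z → V) →ₗ[ℝ] (Z → V)) (Qs1 : (Y → V) →ₗ[ℝ] (Z → V))
    {ak ak1 a L c₁ p1 pp : ℝ} {d : ℕ} {A' : X → V} {B : Y → V}
    (hfirst : ∀ (f : X → V) (M : ℝ), (∀ x, ‖f x‖ ≤ M) →
      ∀ z, ‖bgField ak 1 G Qsk f z‖ ≤ c₁ * M ∧ ‖lapA (bgField ak 1 G Qsk f) z‖ ≤ c₁ * M)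
    (h342 : bgField ak 1 G Qsk ((a * (L ^ 2)⁻¹) • C (Qs B)) = bgField ak1 L G1 Qs1 B)
    (hchi : SmallFluct p1 (fun x => ‖A' x‖))
    (hchi1 : ∀ z, SmallFieldAt d L pp ‖bgField ak1 L G1 Qs1 B z‖ ‖lapA (bgField ak1 L G1 Qs1 B) z‖) (z : Z) :
    ‖bgField ak 1 G Qsk (transl310 (a * (L ^ 2)⁻¹) C Qs A' B) z‖ ≤ c₁ * p1 + L ^ (-(((d : ℝ) - 2) / 2)) * pp
      ∧ ‖lapA (bgField ak 1 G Qsk (transl310 (a * (L ^ 2)⁻¹) C Qs A' B)) z‖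
        ≤ c₁ * p1 + L ^ (-(((d : ℝ) + 2) / 2)) * pp := by
  have h := ineq353 G lapA lapA Qsk C Qs G1 Qs1 (c₂ := 0) (ℓk := 1) (α := 1) (d := d) hfirst
    (fun z => by rw [h342, sub_self, sub_self]; simp) hchi hchi1 z
  simpa using h

/-! ## §3 The sentence p. 622: `χ_k(φ′ + aL⁻²C^{(k)}Q*ψ)` is redundant on the support of `χ_{k+1}(ψ)χ(φ′)` -/

/-- **p. 622, the sentence after (3.53)**: if `c₁p₁ + pp + c₂ℓk^α ≤ pk` (the inequality served by (3.54), with `p1 = p₁(L^kε)`,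
`pp = p(L^{k+1}ε) ≥ 0`, `pk = p(L^kε)`), `L ≥ 1` and `d ≥ 2` (so that `L^{−(d−2)/2} ≤ 1`, `L^{−(d+2)/2} ≤ 1` — the paper has
`d = 2, 3`), then under (H1), (H2), `χ(φ′) = 1` and `χ_{k+1}(ψ) = 1` the level-k restriction `χ_k` of (3.27)–(3.28) HOLDS for
the translated field: `|φ^{(k)}(z)| ≤ p(L^kε)`, `|(Δ_Ãφ^{(k)})(z)| ≤ p(L^kε)` at every site (`SmallFieldUnit`, the rescaled
(3.28) = (3.9)-shape) — i.e. `χ_k(φ′ + aL⁻²C^{(k)}(B^{(k+1)})Q*(B^{(k+1)})ψ) = 1`. [cite: Balaban1982Higgs1, (3.54) p.622] -/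
theorem chi_k_of_ineq354 (G1 : (Z → V) →ₗ[ℝ] (Z → V)) (Qs1 : (Y → V) →ₗ[ℝ] (Z → V))
    {ak ak1 a L c₁ c₂ ℓk α p1 pp pk : ℝ} {d : ℕ} {φ' : X → V} {ψ : Y → V} (hd : 2 ≤ d) (hL : 1 ≤ L) (hpp : 0 ≤ pp)
    (h354 : c₁ * p1 + pp + c₂ * ℓk ^ α ≤ pk)
    (hfirst : ∀ (f : X → V) (M : ℝ), (∀ x, ‖f x‖ ≤ M) →
      ∀ z, ‖bgField ak 1 G Qsk f z‖ ≤ c₁ * M ∧ ‖lapA (bgField ak 1 G Qsk f) z‖ ≤ c₁ * M)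
    (hsecond : ∀ z, ‖(bgField ak 1 G Qsk ((a * (L ^ 2)⁻¹) • C (Qs ψ)) - bgField ak1 L G1 Qs1 ψ) z‖ ≤ c₂ * ℓk ^ α
      ∧ ‖(lapA (bgField ak 1 G Qsk ((a * (L ^ 2)⁻¹) • C (Qs ψ))) - lapB (bgField ak1 L G1 Qs1 ψ)) z‖ ≤ c₂ * ℓk ^ α)
    (hchi : SmallFluct p1 (fun x => ‖φ' x‖))
    (hchi1 : ∀ z, SmallFieldAt d L pp ‖bgField ak1 L G1 Qs1 ψ z‖ ‖lapB (bgField ak1 L G1 Qs1 ψ) z‖) :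
    SmallFieldUnit pk (fun z => ‖bgField ak 1 G Qsk (transl310 (a * (L ^ 2)⁻¹) C Qs φ' ψ) z‖)
      (fun z => ‖lapA (bgField ak 1 G Qsk (transl310 (a * (L ^ 2)⁻¹) C Qs φ' ψ)) z‖) := by
  intro z
  obtain ⟨h1, h2⟩ := ineq353 G lapA lapB Qsk C Qs G1 Qs1 hfirst hsecond hchi hchi1 z
  have hd' : (2 : ℝ) ≤ d := by exact_mod_cast hd
  have hpow1 : L ^ (-(((d : ℝ) - 2) / 2)) ≤ 1 :=
    Real.rpow_le_one_of_one_le_of_nonpos hL (by linarith)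
  have hpow2 : L ^ (-(((d : ℝ) + 2) / 2)) ≤ 1 :=
    Real.rpow_le_one_of_one_le_of_nonpos hL (by linarith)
  have e1 : L ^ (-(((d : ℝ) - 2) / 2)) * pp ≤ pp := mul_le_of_le_one_left hpp hpow1
  have e2 : L ^ (-(((d : ℝ) + 2) / 2)) * pp ≤ pp := mul_le_of_le_one_left hpp hpow2
  exact ⟨by linarith, by linarith⟩

/-- `p(s) = B2.pFn b₀ p s ≥ 0` for `b₀ ≥ 0` and `0 < s ≤ 1` (then `1 + log s⁻¹ ≥ 1`). [cite: Balaban1982Higgs1, (3.1) p.613] -/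
theorem pFn_nonneg {b₀ p s : ℝ} (hb₀ : 0 ≤ b₀) (hs : 0 < s) (hs1 : s ≤ 1) : 0 ≤ B2.pFn b₀ p s := by
  unfold B2.pFn
  refine mul_nonneg hb₀ (Real.rpow_nonneg ?_ _)
  rw [Real.log_inv]
  have := Real.log_nonpos hs.le hs1
  linarith

/-- **The sentence with the printed thresholds**: `p1 = p₁(L^kε) = B2.pFn b₁ p₁ ℓk`, `pp = p(L^{k+1}ε) = B2.pFn b₀ p (L·ℓk)`,
`pk = p(L^kε) = B2.pFn b₀ p ℓk`, the inequality `B1Sect3Statements.Ineq354 b₀ p b₁ p₁ L c₁ c₂ α ℓk` (*"if c₁p₁(L^kε) +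
p(L^{k+1}ε) + c₂(L^kε)^α ≤ p(L^kε)"*), `b₀ ≥ 0`, `0 < L^kε`, *"where we have assumed L^{k+1}ε ≤ 1"*, `L ≥ 1`, `d ≥ 2`:
then `χ_k(φ′ + aL⁻²C^{(k)}(B^{(k+1)})Q*(B^{(k+1)})ψ) = 1`. [cite: Balaban1982Higgs1, (3.54) p.622] -/
theorem chi_k_of_ineq354_printed (G1 : (Z → V) →ₗ[ℝ] (Z → V)) (Qs1 : (Y → V) →ₗ[ℝ] (Z → V))
    {ak ak1 a L c₁ c₂ ℓk α b₀ p b₁ p₁ : ℝ} {d : ℕ} {φ' : X → V} {ψ : Y → V} (hd : 2 ≤ d) (hL : 1 ≤ L) (hb₀ : 0 ≤ b₀)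
    (hℓk : 0 < ℓk) (hLℓ : L * ℓk ≤ 1) (h354 : Ineq354 b₀ p b₁ p₁ L c₁ c₂ α ℓk)
    (hfirst : ∀ (f : X → V) (M : ℝ), (∀ x, ‖f x‖ ≤ M) →
      ∀ z, ‖bgField ak 1 G Qsk f z‖ ≤ c₁ * M ∧ ‖lapA (bgField ak 1 G Qsk f) z‖ ≤ c₁ * M)
    (hsecond : ∀ z, ‖(bgField ak 1 G Qsk ((a * (L ^ 2)⁻¹) • C (Qs ψ)) - bgField ak1 L G1 Qs1 ψ) z‖ ≤ c₂ * ℓk ^ α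
      ∧ ‖(lapA (bgField ak 1 G Qsk ((a * (L ^ 2)⁻¹) • C (Qs ψ))) - lapB (bgField ak1 L G1 Qs1 ψ)) z‖ ≤ c₂ * ℓk ^ α)
    (hchi : SmallFluct (B2.pFn b₁ p₁ ℓk) (fun x => ‖φ' x‖))
    (hchi1 : ∀ z, SmallFieldAt d L (B2.pFn b₀ p (L * ℓk)) ‖bgField ak1 L G1 Qs1 ψ z‖
      ‖lapB (bgField ak1 L G1 Qs1 ψ) z‖) :
    SmallFieldUnit (B2.pFn b₀ p ℓk) (fun z => ‖bgField ak 1 G Qsk (transl310 (a * (L ^ 2)⁻¹) C Qs φ' ψ) z‖)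
      (fun z => ‖lapA (bgField ak 1 G Qsk (transl310 (a * (L ^ 2)⁻¹) C Qs φ' ψ)) z‖) :=
  chi_k_of_ineq354 G lapA lapB Qsk C Qs G1 Qs1 hd hL
    (pFn_nonneg hb₀ (by positivity) hLℓ) h354 hfirst hsecond hchi hchi1

/-- Products of {0,1}-valued characteristic functions: if `P` and `R` together imply `Q`, then `χ_P·χ_Q·χ_R = χ_P·χ_R`.
[cite: Balaban1982Higgs1, (3.54) p.622] -/
theorem indicator_mul_redundant (P Q R : Prop) [Decidable P] [Decidable Q] [Decidable R] (h : P → R → Q) :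
    (if P then (1 : ℝ) else 0) * (if Q then (1 : ℝ) else 0) * (if R then (1 : ℝ) else 0)
      = (if P then (1 : ℝ) else 0) * (if R then (1 : ℝ) else 0) := by
  by_cases hP : P
  · by_cases hR : R
    · simp [hP, hR, h hP hR]
    · simp [hR]
  · simp [hP]

open Classical in
/-- **p. 622, AS PRINTED** — the identity of characteristic functions
`χ_{k+1}(ψ)·χ_k(φ′ + aL⁻²C^{(k)}(B^{(k+1)})Q*(B^{(k+1)})ψ)·χ(φ′) = χ_{k+1}(ψ)·χ(φ′)` (the `χ`'s as the {0,1}-valued functions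
of the field configurations they are in (3.51)), under the inequality of (3.54), `L ≥ 1`, `d ≥ 2`, `p(L^{k+1}ε) ≥ 0`, (H1), (H2).
[cite: Balaban1982Higgs1, (3.54) p.622] -/
theorem chi_product_eq (G1 : (Z → V) →ₗ[ℝ] (Z → V)) (Qs1 : (Y → V) →ₗ[ℝ] (Z → V))
    {ak ak1 a L c₁ c₂ ℓk α p1 pp pk : ℝ} {d : ℕ} (φ' : X → V) (ψ : Y → V) (hd : 2 ≤ d) (hL : 1 ≤ L) (hpp : 0 ≤ pp)
    (h354 : c₁ * p1 + pp + c₂ * ℓk ^ α ≤ pk)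
    (hfirst : ∀ (f : X → V) (M : ℝ), (∀ x, ‖f x‖ ≤ M) →
      ∀ z, ‖bgField ak 1 G Qsk f z‖ ≤ c₁ * M ∧ ‖lapA (bgField ak 1 G Qsk f) z‖ ≤ c₁ * M)
    (hsecond : (∀ z, SmallFieldAt d L pp ‖bgField ak1 L G1 Qs1 ψ z‖ ‖lapB (bgField ak1 L G1 Qs1 ψ) z‖) →
      SmallFluct p1 (fun x => ‖φ' x‖) →
      ∀ z, ‖(bgField ak 1 G Qsk ((a * (L ^ 2)⁻¹) • C (Qs ψ)) - bgField ak1 L G1 Qs1 ψ) z‖ ≤ c₂ * ℓk ^ α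
        ∧ ‖(lapA (bgField ak 1 G Qsk ((a * (L ^ 2)⁻¹) • C (Qs ψ))) - lapB (bgField ak1 L G1 Qs1 ψ)) z‖ ≤ c₂ * ℓk ^ α) :
    (if (∀ z, SmallFieldAt d L pp ‖bgField ak1 L G1 Qs1 ψ z‖ ‖lapB (bgField ak1 L G1 Qs1 ψ) z‖) then (1 : ℝ) else 0)
      * (if SmallFieldUnit pk (fun z => ‖bgField ak 1 G Qsk (transl310 (a * (L ^ 2)⁻¹) C Qs φ' ψ) z‖)
            (fun z => ‖lapA (bgField ak 1 G Qsk (transl310 (a * (L ^ 2)⁻¹) C Qs φ' ψ)) z‖) then (1 : ℝ) else 0)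
      * (if SmallFluct p1 (fun x => ‖φ' x‖) then (1 : ℝ) else 0)
    = (if (∀ z, SmallFieldAt d L pp ‖bgField ak1 L G1 Qs1 ψ z‖ ‖lapB (bgField ak1 L G1 Qs1 ψ) z‖) then (1 : ℝ) else 0)
      * (if SmallFluct p1 (fun x => ‖φ' x‖) then (1 : ℝ) else 0) :=
  indicator_mul_redundant _ _ _ fun hchi1 hchi =>
    chi_k_of_ineq354 G lapA lapB Qsk C Qs G1 Qs1 hd hL hpp h354 hfirst (hsecond hchi1 hchi) hchi hchi1

end Model

/-! ## §4 (3.51) ⇒ (3.55): the redundant `χ_k`'s dropped, the Gaussian normalisations factored out -/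

section Step355

variable {Ω ΩA Ωφ : Type*} [MeasurableSpace Ω] [MeasurableSpace ΩA] [MeasurableSpace Ωφ]

/-- **Gaussian-normalisation bookkeeping of (3.55), one field**: if the non-negative density `g` (↤ `exp(−½⟨A′,(C^{(k)})⁻¹A′⟩)`)
satisfies `g·dν = N·dμ` (`ν` ↤ the Lebesgue measure `dA′`, `μ` ↤ the normalised Gaussian measure `dμ_{C^{(k)}}`, `N ≥ 0` ↤
`∫dA′ exp(−½⟨A′,(C^{(k)})⁻¹A′⟩)`), then `∫dA′ F(A′)g(A′) = N·∫dμ_{C^{(k)}}(A′) F(A′)` for every `F`.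
[cite: Balaban1982Higgs1, (3.55) p.622] -/
theorem integral_mul_density_eq (ν μ : Measure Ω) {g : Ω → ℝ} {N : ℝ} (hg : Measurable g) (hg0 : ∀ x, 0 ≤ g x)
    (hN : 0 ≤ N) (hμ : ν.withDensity (fun x => ENNReal.ofReal (g x)) = ENNReal.ofReal N • μ) (F : Ω → ℝ) :
    ∫ x, F x * g x ∂ν = N * ∫ x, F x ∂μ := by
  have h1 : ∫ x, F x ∂(ν.withDensity (fun x => ENNReal.ofReal (g x))) = ∫ x, (g x).toNNReal • F x ∂ν :=
    integral_withDensity_eq_integral_smul hg.real_toNNReal F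
  have h2 : (fun x => (g x).toNNReal • F x) = fun x => F x * g x := by
    funext x
    rw [NNReal.smul_def, smul_eq_mul, Real.coe_toNNReal _ (hg0 x), mul_comm]
  rw [← h2, ← h1, hμ, integral_smul_measure, ENNReal.toReal_ofReal hN, smul_eq_mul]

/-- With `μ` a probability measure the constant IS the printed normalisation: `N = ∫dA′ exp(−½⟨A′,(C^{(k)})⁻¹A′⟩)`.
[cite: Balaban1982Higgs1, (3.55) p.622] -/
theorem density_norm_eq (ν μ : Measure Ω) [IsProbabilityMeasure μ] {g : Ω → ℝ} {N : ℝ} (hg : Measurable g)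
    (hg0 : ∀ x, 0 ≤ g x) (hN : 0 ≤ N) (hμ : ν.withDensity (fun x => ENNReal.ofReal (g x)) = ENNReal.ofReal N • μ) :
    ∫ x, g x ∂ν = N := by
  have h := integral_mul_density_eq ν μ hg hg0 hN hμ (fun _ => 1)
  simpa using h

/-- The normalised measure EXISTS whenever `0 < N = ∫g dν < ∞` (`g ≥ 0` measurable, `ν`-integrable):
`μ := N⁻¹·(g·dν)` is a probability measure with `g·dν = N·dμ`. [cite: Balaban1982Higgs1, (3.55) p.622] -/
theorem normalized_exists (ν : Measure Ω) {g : Ω → ℝ} (hg0 : ∀ x, 0 ≤ g x) (hgi : Integrable g ν)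
    (hN : 0 < ∫ x, g x ∂ν) :
    ∃ μ : Measure Ω, IsProbabilityMeasure μ ∧
      ν.withDensity (fun x => ENNReal.ofReal (g x)) = ENNReal.ofReal (∫ x, g x ∂ν) • μ := by
  set N := ∫ x, g x ∂ν with hNdef
  have hN0 : ENNReal.ofReal N ≠ 0 := by simpa [ENNReal.ofReal_eq_zero, not_le] using hN
  have hNtop : ENNReal.ofReal N ≠ ⊤ := ENNReal.ofReal_ne_top
  have htot : ν.withDensity (fun x => ENNReal.ofReal (g x)) Set.univ = ENNReal.ofReal N := by
    rw [withDensity_apply _ MeasurableSet.univ, Measure.restrict_univ,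
      ← ofReal_integral_eq_lintegral_ofReal hgi (Filter.Eventually.of_forall hg0)]
  refine ⟨(ENNReal.ofReal N)⁻¹ • ν.withDensity (fun x => ENNReal.ofReal (g x)), ⟨?_⟩, ?_⟩
  · rw [Measure.smul_apply, htot, smul_eq_mul, ENNReal.inv_mul_cancel hN0 hNtop]
  · rw [smul_smul, ENNReal.mul_inv_cancel hN0 hNtop, one_smul]

/-- **(3.51) ⇒ (3.55), the mechanism**: in the double fluctuation integral of (3.51) — `χ_k(A′ + aL⁻²C^{(k)}Q*B)`·
`χ_k(φ′ + aL⁻²C^{(k)}(B^{(k+1)})Q*(B^{(k+1)})ψ)`·`χ(A′)χ(φ′)`·`g_A(A′)g_φ(φ′)W(A′,φ′)` integrated `dφ′` then `dA′` — the two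
`χ_k` factors may be DROPPED when they equal `1` wherever `χ(A′)χ(φ′) ≠ 0` (the sentence p. 622, for the vector and the
scalar field; `B, ψ` fixed with `χ_{k+1}(B)χ_{k+1}(ψ) ≠ 0`), and the Gaussian densities `g_A = exp(−½⟨A′,(C^{(k)})⁻¹A′⟩)`,
`g_φ = exp(−½⟨φ′,(C^{(k)}(B^{(k+1)}))⁻¹φ′⟩)` turn `dA′, dφ′` into `N_A·dμ_{C^{(k)}}`, `N_φ·dμ_{C^{(k)}(B^{(k+1)})}`.
[cite: Balaban1982Higgs1, (3.55) p.622] -/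
theorem step355 (νA μA : Measure ΩA) (νφ μφ : Measure Ωφ) {gA : ΩA → ℝ} {gφ : Ωφ → ℝ} {NA Nφ : ℝ}
    (hgA : Measurable gA) (hgφ : Measurable gφ) (hgA0 : ∀ a, 0 ≤ gA a) (hgφ0 : ∀ f, 0 ≤ gφ f) (hNA : 0 ≤ NA)
    (hNφ : 0 ≤ Nφ) (hμA : νA.withDensity (fun a => ENNReal.ofReal (gA a)) = ENNReal.ofReal NA • μA)
    (hμφ : νφ.withDensity (fun f => ENNReal.ofReal (gφ f)) = ENNReal.ofReal Nφ • μφ)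
    (χkA χA : ΩA → ℝ) (χkφ W : ΩA → Ωφ → ℝ) (χφ : Ωφ → ℝ)
    (hred : ∀ a f, χA a ≠ 0 → χφ f ≠ 0 → χkA a * χkφ a f = 1) :
    ∫ a, ∫ f, χkA a * χkφ a f * (χA a * χφ f) * (gA a * gφ f * W a f) ∂νφ ∂νA
      = NA * Nφ * ∫ a, ∫ f, χA a * χφ f * W a f ∂μφ ∂μA := by
  -- pointwise: the `χ_k` factors are redundant
  have hpt : ∀ a f, χkA a * χkφ a f * (χA a * χφ f) * (gA a * gφ f * W a f)
      = (χA a * χφ f * W a f * gA a) * gφ f := by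
    intro a f
    by_cases h0 : χA a * χφ f = 0
    · rw [h0]; ring
    · obtain ⟨hA, hφ⟩ := mul_ne_zero_iff.1 h0
      rw [hred a f hA hφ]; ring
  simp_rw [hpt]
  -- inner integral: `dφ′ g_φ = N_φ dμ_φ`, then pull out `g_A(a)`
  have hinner : ∀ a, ∫ f, χA a * χφ f * W a f * gA a * gφ f ∂νφ
      = (Nφ * ∫ f, χA a * χφ f * W a f ∂μφ) * gA a := by
    intro a
    rw [integral_mul_density_eq νφ μφ hgφ hgφ0 hNφ hμφ]
    rw [show (fun f => χA a * χφ f * W a f * gA a) = fun f => χA a * χφ f * W a f * gA a from rfl,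
      integral_mul_const]
    ring
  simp_rw [hinner]
  -- outer integral: `dA′ g_A = N_A dμ_A`
  rw [integral_mul_density_eq νA μA hgA hgA0 hNA hμA]
  rw [show (fun a => Nφ * ∫ f, χA a * χφ f * W a f ∂μφ) = fun a => Nφ * ∫ f, χA a * χφ f * W a f ∂μφ from rfl,
    integral_const_mul]
  ring

/-- **(3.51) = (3.55)** in the printed shape: with the exponent of (3.51) `−½q_A(A′) − ½q_φ(φ′) + V^{(k)}(A′,φ′) − E₀ + R`
(`q_A(A′) = ⟨A′,(C^{(k)})⁻¹A′⟩`, `q_φ(φ′) = ⟨φ′,(C^{(k)}(B^{(k+1)}))⁻¹φ′⟩` measurable, `R` ↤ the number `O(1)(L^kε)^κ|T₁^{(k)}|`)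
and the normalised Gaussian measures `μ_A, μ_φ` (`e^{−½q}·dν = N·dμ`), the double integral of (3.51) equals
`N_A·N_φ·e^{−E₀+R}·∫dμ_{C^{(k)}}(A′)∫dμ_{C^{(k)}(B^{(k+1)})}(φ′)χ(A′)χ(φ′)exp(V^{(k)})` — the last factor being exactly the
fluctuation integral (3.56) `B1Sect3Statements.integral356`. [cite: Balaban1982Higgs1, (3.55) p.622] -/
theorem eq355 (νA μA : Measure ΩA) (νφ μφ : Measure Ωφ) {qA : ΩA → ℝ} {qφ : Ωφ → ℝ} {NA Nφ : ℝ}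
    (hqA : Measurable qA) (hqφ : Measurable qφ) (hNA : 0 ≤ NA) (hNφ : 0 ≤ Nφ)
    (hμA : νA.withDensity (fun a => ENNReal.ofReal (Real.exp (-(qA a) / 2))) = ENNReal.ofReal NA • μA)
    (hμφ : νφ.withDensity (fun f => ENNReal.ofReal (Real.exp (-(qφ f) / 2))) = ENNReal.ofReal Nφ • μφ)
    (χkA χA : ΩA → ℝ) (χkφ V : ΩA → Ωφ → ℝ) (χφ : Ωφ → ℝ) (E₀ R : ℝ)
    (hred : ∀ a f, χA a ≠ 0 → χφ f ≠ 0 → χkA a * χkφ a f = 1) :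
    ∫ a, ∫ f, χkA a * χkφ a f * (χA a * χφ f)
        * Real.exp (-(qA a) / 2 - qφ f / 2 + (V a f - E₀ + R)) ∂νφ ∂νA
      = NA * Nφ * (Real.exp (-E₀ + R) * integral356 μA μφ χA χφ V) := by
  have hexp : ∀ a f, Real.exp (-(qA a) / 2 - qφ f / 2 + (V a f - E₀ + R))
      = Real.exp (-(qA a) / 2) * Real.exp (-(qφ f) / 2) * (Real.exp (V a f) * Real.exp (-E₀ + R)) := by
    intro a f
    rw [← Real.exp_add, ← Real.exp_add, ← Real.exp_add]
    ring_nf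
  simp_rw [hexp]
  have hmA : Measurable (fun a => Real.exp (-(qA a) / 2)) := by fun_prop
  have hmφ : Measurable (fun f => Real.exp (-(qφ f) / 2)) := by fun_prop
  rw [step355 νA μA νφ μφ hmA hmφ (fun _ => Real.exp_nonneg _)
    (fun _ => Real.exp_nonneg _) hNA hNφ hμA hμφ χkA χA χkφ _ χφ hred]
  congr 1
  unfold integral356
  have hin : ∀ a, ∫ f, χA a * χφ f * (Real.exp (V a f) * Real.exp (-E₀ + R)) ∂μφ
      = (∫ f, χA a * χφ f * Real.exp (V a f) ∂μφ) * Real.exp (-E₀ + R) := by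
    intro a
    rw [← integral_mul_const]
    congr 1
    funext f
    ring
  simp_rw [hin]
  rw [integral_mul_const, mul_comm]

/-- **(3.55) p. 622, the printed inequality**: multiplying by the common non-negative prefactor `K` ↤ `const·Z_kZ_k(B^{(k+1)})
·exp(−½⟨B,Δ^{(k+1),L}B⟩ − ½⟨ψ,Δ^{(k+1),L}(B^{(k+1)})ψ⟩)·χ_{k+1}(B)χ_{k+1}(ψ)`, *"(the right side of (3.51)) ≥ const Z_kZ_k(B^{(k+1)})
exp(…)(∫dA′e^{−½q_A})(∫dφ′e^{−½q_φ})χ_{k+1}(B)χ_{k+1}(ψ)∫dμ_{C^{(k)}}(A′)∫dμ_{C^{(k)}(B^{(k+1)})}(φ′)χ(A′)χ(φ′)exp(V^{(k)} − E₀ +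
O(1)(L^kε)^κ|T₁^{(k)}|)"* — with equality, by `eq355`. [cite: Balaban1982Higgs1, (3.55) p.622] -/
theorem ineq355 (νA μA : Measure ΩA) (νφ μφ : Measure Ωφ) {qA : ΩA → ℝ} {qφ : Ωφ → ℝ} {NA Nφ : ℝ} (K : ℝ)
    (hqA : Measurable qA) (hqφ : Measurable qφ) (hNA : 0 ≤ NA) (hNφ : 0 ≤ Nφ)
    (hμA : νA.withDensity (fun a => ENNReal.ofReal (Real.exp (-(qA a) / 2))) = ENNReal.ofReal NA • μA)
    (hμφ : νφ.withDensity (fun f => ENNReal.ofReal (Real.exp (-(qφ f) / 2))) = ENNReal.ofReal Nφ • μφ)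
    (χkA χA : ΩA → ℝ) (χkφ V : ΩA → Ωφ → ℝ) (χφ : Ωφ → ℝ) (E₀ R : ℝ)
    (hred : ∀ a f, χA a ≠ 0 → χφ f ≠ 0 → χkA a * χkφ a f = 1) :
    K * (NA * Nφ * ∫ a, ∫ f, χA a * χφ f * Real.exp (V a f - E₀ + R) ∂μφ ∂μA)
      ≤ K * ∫ a, ∫ f, χkA a * χkφ a f * (χA a * χφ f)
        * Real.exp (-(qA a) / 2 - qφ f / 2 + (V a f - E₀ + R)) ∂νφ ∂νA := by
  refine le_of_eq ?_
  rw [eq355 νA μA νφ μφ hqA hqφ hNA hNφ hμA hμφ χkA χA χkφ V χφ E₀ R hred]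
  congr 2
  unfold integral356
  have hin : ∀ a, ∫ f, χA a * χφ f * Real.exp (V a f - E₀ + R) ∂μφ
      = (∫ f, χA a * χφ f * Real.exp (V a f) ∂μφ) * Real.exp (-E₀ + R) := by
    intro a
    rw [← integral_mul_const]
    congr 1
    funext f
    rw [show V a f - E₀ + R = V a f + (-E₀ + R) by ring, Real.exp_add]
    ring
  simp_rw [hin]
  rw [integral_mul_const, mul_comm]

end Step355

end Literature.MathematicalPhysics.QuantumFieldTheory.Balaban1983to89.B1Ineq353Proof
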